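import Mathlib.Computability.StateTransition
import Mathlib.Data.Nat.Size
import Mathlib.Data.Nat.Bitwise
import Mathlib.Data.Real.Basic
import Mathlib.Data.Fintype.Pi
import Mathlib.Data.Fintype.BigOperators
import Mathlib.Logic.Function.Basic
import HarnessLib

-- provenance: harness21/H21/H21/Prelude/CryptoQuantFine/WordRAM.lean @ bb47fed (interim HEAD d8f2665); M5 mechanical rewrite
/-!
# The word RAM (trunk CryptoQuantFine, item F4)

A concrete unit-cost word RAM, the machine model of fine-grained complexity
(Fredman–Willard, *Surpassing the information-theoretic bound with fusion trees*, JCSS 1993;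
Hagerup, *Sorting and searching on the word RAM*, STACS 1998, §2;
V. Vassilevska Williams, *On some fine-grained questions in algorithms and complexity*,
ICM 2018, §2).

* Memory is `ℕ → ℕ`, each cell holding a `w`-bit word (all writes are reduced modulo `2 ^ w`).
* Operands are immediate / direct / indirect (`Operand`).
* Unit-cost binary operations `+ − × ÷ mod and or xor shl shr < =` (`BinOp`); multiplication is
  unit-cost, as is customary in the fine-grained literature.
* Instructions (`Instr`): a three-address `op`, unconditional and zero-conditional jumps, `rand`
  (write a uniformly random word taken from a coin stream `ρ : ℕ → ℕ`), `query` (call an oracle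
  `O : List ℕ → List ℕ` on a memory segment, logging the query) and `halt`.
* Small-step semantics `step : Cfg → Option Cfg`, so that Mathlib's
  `StateTransition.EvalsToInTime`, `StateTransition.eval`, `StateTransition.Reaches`
  measure time exactly (one instruction = one step).
* Input convention `init`: on input `x : List ℕ`, `mem 0 = |x|` and `mem (i+1) = xᵢ` (reduced
  mod `2 ^ w`); the output is read back the same way (`readOut`).
* `OutputsWithin`, `HaltsWithin` (time-bounded runs), `inputWidth` (the "Θ(log n)-bit word"
  convention: a run on `x` uses `w := k * inputWidth x`), and `successProb` (probability over
  uniformly random coin words that the output lands in a target set within `t` steps).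

Mathlib anchors used: `StateTransition.EvalsToInTime` (time-bounded evaluation certificates),
`Function.update`, `Nat.size`, the bit operations `&&& ||| ^^^ <<< >>>` on `ℕ`. Mathlib has no
random-access machine model (only Turing machines `Turing.TM0/TM1/TM2` and partial recursive
functions), hence the definitions below.

Design choices (documented junk values): `x / 0 = 0` and `x % 0 = x` (Lean's conventions);
subtraction wraps modulo `2 ^ w`; writing to an immediate operand is a no-op; jumping to a
program counter outside the program halts on the next step.
-/

namespace Literature.Computability.Cryptography.WordRAM

open StateTransition

/-! ## Syntax -/

/-- Operands of the word RAM: an immediate constant `imm c`, a direct memory reference `dir a`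
(the cell `mem a`), or an indirect reference `ind a` (the cell `mem (mem a)`).
Hagerup 1998, §2. [cite: Hagerup1998, §2] -/
inductive Operand
  /-- Immediate constant `c`. -/
  | imm (c : ℕ)
  /-- Direct address: the contents of cell `a`. -/
  | dir (a : ℕ)
  /-- Indirect address: the contents of cell `mem a`. -/
  | ind (a : ℕ)
  deriving DecidableEq, Inhabited

/-- The value of an operand in memory `mem`. Hagerup 1998, §2. [cite: Hagerup1998, §2] -/
def Operand.read (mem : ℕ → ℕ) : Operand → ℕ
  | .imm c => c
  | .dir a => mem a
  | .ind a => mem (mem a)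

/-- Write the value `v` to the location designated by an operand; writing to an immediate
operand is a no-op (documented junk convention). Hagerup 1998, §2. [cite: Hagerup1998, §2] -/
def Operand.write (mem : ℕ → ℕ) (v : ℕ) : Operand → (ℕ → ℕ)
  | .imm _ => mem
  | .dir a => Function.update mem a v
  | .ind a => Function.update mem (mem a) v

/-- Reading an immediate operand. [folklore] -/
@[simp] theorem Operand.read_imm (mem : ℕ → ℕ) (c : ℕ) : (Operand.imm c).read mem = c := rfl
/-- Reading a direct operand. [folklore] -/
@[simp] theorem Operand.read_dir (mem : ℕ → ℕ) (a : ℕ) : (Operand.dir a).read mem = mem a := rfl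
/-- Reading an indirect operand. [folklore] -/
@[simp] theorem Operand.read_ind (mem : ℕ → ℕ) (a : ℕ) :
    (Operand.ind a).read mem = mem (mem a) := rfl
/-- Writing to an immediate operand is a no-op. [folklore] -/
@[simp] theorem Operand.write_imm (mem : ℕ → ℕ) (v c : ℕ) : (Operand.imm c).write mem v = mem :=
  rfl

/-- The unit-cost binary operations of the word RAM: arithmetic `+ − × ÷ mod`, bitwise
`and or xor`, shifts, and the comparisons `<`, `=` (returning `0`/`1`).
Fredman–Willard 1993; V. Vassilevska Williams ICM 2018, §2. [cite: FredmanWillard1993] -/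
inductive BinOp
  | add | sub | mul | div | mod | band | bor | bxor | shl | shr | lt | eq
  deriving DecidableEq, Inhabited

/-- Semantics of the binary operations on `w`-bit words: results are reduced modulo `2 ^ w`
(where they could exceed it); `sub` wraps around; `x / 0 = 0` and `x % 0 = x` (Lean's
conventions, documented junk values). Hagerup 1998, §2. [cite: Hagerup1998, §2] -/
def BinOp.eval (w : ℕ) : BinOp → ℕ → ℕ → ℕ
  | .add, x, y => (x + y) % 2 ^ w
  | .sub, x, y => (x + 2 ^ w - y % 2 ^ w) % 2 ^ w
  | .mul, x, y => (x * y) % 2 ^ w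
  | .div, x, y => x / y
  | .mod, x, y => x % y
  | .band, x, y => x &&& y
  | .bor, x, y => (x ||| y) % 2 ^ w
  | .bxor, x, y => (x ^^^ y) % 2 ^ w
  | .shl, x, y => (x <<< y) % 2 ^ w
  | .shr, x, y => x >>> y
  | .lt, x, y => if x < y then 1 else 0
  | .eq, x, y => if x = y then 1 else 0

/-- Instructions of the word RAM.
* `op o dst x y`: `dst := o x y`;
* `jmp t`: jump to instruction `t`;
* `jz x t`: jump to `t` if operand `x` reads `0`, else fall through;
* `rand dst`: write the next coin word to `dst`;
* `query qAddr qLen aAddr`: call the oracle on the memory segment of length `qLen` starting at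
  address `qAddr`; the answer's length is written at address `aAddr` and its words after it;
* `halt`.
V. Vassilevska Williams ICM 2018, §2 (oracle calls as in Def. 2.1 of fine-grained reductions). [cite: ICM2018, §2 (oracle calls as in Def. 2.1 of fine] -/
inductive Instr
  /-- Three-address operation `dst := o x y`. -/
  | op (o : BinOp) (dst x y : Operand)
  /-- Unconditional jump. -/
  | jmp (t : ℕ)
  /-- Jump if zero. -/
  | jz (x : Operand) (t : ℕ)
  /-- Write a uniformly random word to `dst`. -/
  | rand (dst : Operand)
  /-- Oracle query on a memory segment. -/
  | query (qAddr qLen aAddr : Operand)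
  /-- Halt. -/
  | halt
  deriving DecidableEq, Inhabited

/-- A word-RAM program is a finite list of instructions; the program counter indexes into it.
Hagerup 1998, §2. [cite: Hagerup1998, §2] -/
abbrev Program := List Instr

/-- `I.isRand` holds iff `I` is a `rand` instruction. [folklore] -/
def Instr.isRand : Instr → Bool
  | .rand _ => true
  | _ => false

/-- `I.isQuery` holds iff `I` is an oracle `query` instruction. [folklore] -/
def Instr.isQuery : Instr → Bool
  | .query _ _ _ => true
  | _ => false

/-- A program is deterministic if it contains no `rand` instruction (it then ignores the coin
stream). V. Vassilevska Williams ICM 2018, §2. [cite: ICM2018, §2] -/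
def Program.IsDeterministic (P : Program) : Prop :=
  ∀ I ∈ P, I.isRand = false

/-- A program is oracle-free if it contains no `query` instruction (it then ignores the oracle).
V. Vassilevska Williams ICM 2018, §2. [cite: ICM2018, §2] -/
def Program.IsOracleFree (P : Program) : Prop :=
  ∀ I ∈ P, I.isQuery = false

/-- `instance` — interim instance carried over undocumented from `harness21/H21/H21/Prelude/CryptoQuantFine/WordRAM.lean:158` (docstring generated by the M5 import). [folklore] -/
instance (P : Program) : Decidable P.IsDeterministic :=
  inferInstanceAs (Decidable (∀ I ∈ P, I.isRand = false))

/-- `instance` — interim instance carried over undocumented from `harness21/H21/H21/Prelude/CryptoQuantFine/WordRAM.lean:161` (docstring generated by the M5 import). [folklore] -/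
instance (P : Program) : Decidable P.IsOracleFree :=
  inferInstanceAs (Decidable (∀ I ∈ P, I.isQuery = false))

/-! ## Semantics -/

/-- Configurations of the word RAM: the program counter (`none` = halted), the memory, the
position in the coin stream, and the log of oracle queries made so far (in order).
Hagerup 1998, §2; the query log is used by fine-grained reductions
(V. Vassilevska Williams ICM 2018, Def. 2.1). [cite: ICM2018, Def. 2.1] -/
structure Cfg where
  /-- Program counter; `none` means the machine has halted. -/
  pc : Option ℕ
  /-- Memory: cell `a` holds the word `mem a`. -/
  mem : ℕ → ℕ
  /-- Number of coin words consumed so far. -/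
  coinPos : ℕ
  /-- The oracle queries made so far, oldest first. -/
  queries : List (List ℕ)

/-- The memory segment `[mem a, mem (a+1), …, mem (a+len-1)]`. [folklore] -/
def readSeg (mem : ℕ → ℕ) (a len : ℕ) : List ℕ :=
  (List.range len).map fun i => mem (a + i)

/-- Write the list `l` into memory starting at address `a` (cell `a + i` receives `l[i]`). [folklore] -/
def writeSeg (mem : ℕ → ℕ) (a : ℕ) : List ℕ → (ℕ → ℕ)
  | [] => mem
  | v :: l => writeSeg (Function.update mem a v) (a + 1) l

/-- A segment read has the requested length. [folklore] -/
@[simp] theorem readSeg_length (mem : ℕ → ℕ) (a len : ℕ) : (readSeg mem a len).length = len := by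
  simp [readSeg]

/-- Writing the empty segment is a no-op. [folklore] -/
@[simp] theorem writeSeg_nil (mem : ℕ → ℕ) (a : ℕ) : writeSeg mem a [] = mem := rfl

/-- Unfolding `writeSeg` on a nonempty list. [folklore] -/
theorem writeSeg_cons (mem : ℕ → ℕ) (a v : ℕ) (l : List ℕ) :
    writeSeg mem a (v :: l) = writeSeg (Function.update mem a v) (a + 1) l := rfl

/-- Cells below the start address are untouched by `writeSeg`. [folklore] -/
theorem writeSeg_apply_of_lt (mem : ℕ → ℕ) (a : ℕ) (l : List ℕ) (b : ℕ) (hb : b < a) :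
    writeSeg mem a l b = mem b := by
  induction l generalizing mem a with
  | nil => rfl
  | cons v l ih =>
    rw [writeSeg_cons, ih _ _ (Nat.lt_succ_of_lt hb), Function.update_of_ne (Nat.ne_of_lt hb)]

/-- One step of program `P` with word size `w`, oracle `O` and coin stream `ρ`.
A halted configuration (`pc = none`) has no successor; a program counter outside `P`, or a
`halt` instruction, halts the machine (`pc := none`); `op`, `rand`, `query` fall through to the
next instruction; `jmp`/`jz` transfer control. `rand dst` writes `ρ coinPos % 2 ^ w` and advances
the coin position; `query qa ql aa` reads the segment `q` of length `ql.read mem` at address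
`qa.read mem`, computes the answer `O q` (words reduced mod `2 ^ w`), writes its length at address
`aa.read mem` and its words right after, and appends `q` to the query log.
Hagerup 1998, §2; V. Vassilevska Williams ICM 2018, §2. [cite: Hagerup1998, §2] -/
def step (P : Program) (w : ℕ) (O : List ℕ → List ℕ) (ρ : ℕ → ℕ) (c : Cfg) : Option Cfg :=
  match c.pc with
  | none => none
  | some i =>
    match P[i]? with
    | none => some { c with pc := none }
    | some .halt => some { c with pc := none }
    | some (.op o dst x y) =>
      some { c with pc := some (i + 1), mem := dst.write c.mem (o.eval w (x.read c.mem) (y.read c.mem)) }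
    | some (.jmp t) => some { c with pc := some t }
    | some (.jz x t) => some { c with pc := if x.read c.mem = 0 then some t else some (i + 1) }
    | some (.rand dst) =>
      some { c with pc := some (i + 1), mem := dst.write c.mem (ρ c.coinPos % 2 ^ w),
                    coinPos := c.coinPos + 1 }
    | some (.query qa ql aa) =>
      let q := readSeg c.mem (qa.read c.mem) (ql.read c.mem)
      let ans := (O q).map (· % 2 ^ w)
      some { c with pc := some (i + 1),
                    mem := writeSeg (Function.update c.mem (aa.read c.mem) ans.length)
                      (aa.read c.mem + 1) ans,
                    queries := c.queries ++ [q] }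

/-- A configuration has no successor iff it is halted (`pc = none`). [folklore] -/
theorem step_eq_none_iff (P : Program) (w : ℕ) (O : List ℕ → List ℕ) (ρ : ℕ → ℕ) (c : Cfg) :
    step P w O ρ c = none ↔ c.pc = none := by
  unfold step
  cases c.pc with
  | none => simp
  | some i =>
    simp only [reduceCtorEq, iff_false]
    cases P[i]? with
    | none => simp
    | some I => cases I <;> simp

/-- The initial configuration on input `x : List ℕ` with word size `w`: `pc = 0`, `mem 0 = |x|`,
`mem (i+1) = xᵢ` (all reduced mod `2 ^ w`), all other cells `0`, no coins consumed, empty query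
log. V. Vassilevska Williams ICM 2018, §2 (input given in the first `n` words of memory). [cite: ICM2018, §2 (input given in the first  n  words o] -/
def init (w : ℕ) (x : List ℕ) : Cfg where
  pc := some 0
  mem := writeSeg (Function.update (fun _ => 0) 0 (x.length % 2 ^ w)) 1 (x.map (· % 2 ^ w))
  coinPos := 0
  queries := []

/-- The initial program counter is `0`. [folklore] -/
@[simp] theorem init_pc (w : ℕ) (x : List ℕ) : (init w x).pc = some 0 := rfl
/-- Initially no coins are consumed. [folklore] -/
@[simp] theorem init_coinPos (w : ℕ) (x : List ℕ) : (init w x).coinPos = 0 := rfl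
/-- Initially the query log is empty. [folklore] -/
@[simp] theorem init_queries (w : ℕ) (x : List ℕ) : (init w x).queries = [] := rfl

/-- Cell `0` of the initial memory holds the input length (mod `2 ^ w`). [folklore] -/
@[simp] theorem init_mem_zero (w : ℕ) (x : List ℕ) : (init w x).mem 0 = x.length % 2 ^ w := by
  simp only [init]
  rw [writeSeg_apply_of_lt _ _ _ _ Nat.one_pos, Function.update_self]

/-- Cell `i + 1` of the initial memory holds the `i`-th input word (mod `2 ^ w`). [folklore] -/
theorem init_mem_succ (w : ℕ) (x : List ℕ) (i : ℕ) (hi : i < x.length) :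
    (init w x).mem (i + 1) = x[i] % 2 ^ w := by
  simp only [init]
  suffices h : ∀ (l : List ℕ) (mem : ℕ → ℕ) (a j : ℕ) (hj : j < l.length),
      writeSeg mem a l (a + j) = l[j] by
    have := h (x.map (· % 2 ^ w)) (Function.update (fun _ => 0) 0 (x.length % 2 ^ w)) 1 i
      (by simpa using hi)
    rw [Nat.add_comm] at this
    simpa using this
  intro l
  induction l with
  | nil => intro _ _ _ hj; simp at hj
  | cons v l ih =>
    intro mem a j hj
    rw [writeSeg_cons]
    cases j with
    | zero =>
      simp only [Nat.add_zero, List.getElem_cons_zero]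
      rw [writeSeg_apply_of_lt _ _ _ _ (Nat.lt_succ_self a), Function.update_self]
    | succ j =>
      rw [List.getElem_cons_succ, ← ih (Function.update mem a v) (a + 1) j (by simpa using hj)]
      congr 1
      omega

/-- Cells beyond the input are initially `0`. [folklore] -/
theorem init_mem_of_length_lt (w : ℕ) (x : List ℕ) (i : ℕ) (hi : x.length < i) :
    (init w x).mem i = 0 := by
  simp only [init]
  suffices h : ∀ (l : List ℕ) (mem : ℕ → ℕ) (a b : ℕ), a + l.length ≤ b →
      writeSeg mem a l b = mem b by
    rw [h _ _ _ _ (by simp; omega), Function.update_of_ne (by omega)]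
  intro l
  induction l with
  | nil => intros; rfl
  | cons v l ih =>
    intro mem a b hab
    rw [writeSeg_cons, ih _ _ _ (by simp at hab; omega), Function.update_of_ne (by simp at hab; omega)]

/-- The output convention, dual to `init`: the list of length `mem 0` stored in cells
`1, …, mem 0`. V. Vassilevska Williams ICM 2018, §2. [cite: ICM2018, §2] -/
def readOut (mem : ℕ → ℕ) : List ℕ :=
  readSeg mem 1 (mem 0)

/-- The output has length `mem 0`. [folklore] -/
@[simp] theorem readOut_length (mem : ℕ → ℕ) : (readOut mem).length = mem 0 := by
  simp [readOut]

/-- The trivial oracle answering every query with the empty list (used to run oracle-free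
programs). [folklore] -/
def noOracle : List ℕ → List ℕ := fun _ => []

/-- The all-zero coin stream (used to run deterministic programs). [folklore] -/
def zeroCoins : ℕ → ℕ := fun _ => 0

/-- The trivial oracle answers `[]`. [folklore] -/
@[simp] theorem noOracle_apply (q : List ℕ) : noOracle q = [] := rfl
/-- The zero coin stream is `0` everywhere. [folklore] -/
@[simp] theorem zeroCoins_apply (i : ℕ) : zeroCoins i = 0 := rfl

/-! ## Time-bounded runs -/

/-- `HaltsWithin P w O ρ x t c`: started on input `x` (word size `w`, oracle `O`, coins `ρ`),
program `P` reaches the halted configuration `c` within `t` steps. Time is measured by Mathlib's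
`StateTransition.EvalsToInTime` on the small-step function `step`. The final configuration is
exposed so that reductions can inspect `c.queries`.
V. Vassilevska Williams ICM 2018, §2. [cite: ICM2018, §2] -/
def HaltsWithin (P : Program) (w : ℕ) (O : List ℕ → List ℕ) (ρ : ℕ → ℕ) (x : List ℕ) (t : ℕ)
    (c : Cfg) : Prop :=
  Nonempty (EvalsToInTime (step P w O ρ) (init w x) (some c) t) ∧ step P w O ρ c = none

/-- `OutputsWithin P w O ρ x out t`: started on input `x`, program `P` halts within `t` steps
with output `out` (read by `readOut`). V. Vassilevska Williams ICM 2018, §2. [cite: ICM2018, §2] -/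
def OutputsWithin (P : Program) (w : ℕ) (O : List ℕ → List ℕ) (ρ : ℕ → ℕ) (x out : List ℕ)
    (t : ℕ) : Prop :=
  ∃ c, Nonempty (EvalsToInTime (step P w O ρ) (init w x) (some c) t) ∧ step P w O ρ c = none ∧
    readOut c.mem = out

/-- `OutputsWithin` in terms of `HaltsWithin`. [folklore] -/
theorem outputsWithin_iff_exists_haltsWithin (P : Program) (w : ℕ) (O : List ℕ → List ℕ)
    (ρ : ℕ → ℕ) (x out : List ℕ) (t : ℕ) :
    OutputsWithin P w O ρ x out t ↔ ∃ c, HaltsWithin P w O ρ x t c ∧ readOut c.mem = out := by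
  simp only [OutputsWithin, HaltsWithin, and_assoc]

/-- Monotonicity of `HaltsWithin` in the time bound. [folklore] -/
theorem HaltsWithin.mono {P : Program} {w : ℕ} {O : List ℕ → List ℕ} {ρ : ℕ → ℕ} {x : List ℕ}
    {t t' : ℕ} {c : Cfg} (h : HaltsWithin P w O ρ x t c) (ht : t ≤ t') :
    HaltsWithin P w O ρ x t' c := by
  obtain ⟨⟨e⟩, hc⟩ := h
  exact ⟨⟨⟨e.toEvalsTo, e.steps_le_m.trans ht⟩⟩, hc⟩

/-- Monotonicity of `OutputsWithin` in the time bound. [folklore] -/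
theorem OutputsWithin.mono {P : Program} {w : ℕ} {O : List ℕ → List ℕ} {ρ : ℕ → ℕ}
    {x out : List ℕ} {t t' : ℕ} (h : OutputsWithin P w O ρ x out t) (ht : t ≤ t') :
    OutputsWithin P w O ρ x out t' := by
  obtain ⟨c, ⟨e⟩, hc, hout⟩ := h
  exact ⟨c, ⟨⟨e.toEvalsTo, e.steps_le_m.trans ht⟩⟩, hc, hout⟩

/-- The halting configuration of a run is unique (the semantics is a deterministic function of
`P, w, O, ρ, x`). Follows from `StateTransition.reaches_total`. [folklore] -/
def haltsWithin_unique : Prop :=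
  ∀ {P : Program} {w : ℕ} {O : List ℕ → List ℕ} {ρ : ℕ → ℕ} {x : List ℕ} {t t' : ℕ} {c c' : Cfg} (h : HaltsWithin P w O ρ x t c) (h' : HaltsWithin P w O ρ x t' c'),
    c = c'

/-- The output of a run is unique. [folklore] -/
def outputsWithin_unique : Prop :=
  ∀ {P : Program} {w : ℕ} {O : List ℕ → List ℕ} {ρ : ℕ → ℕ} {x out out' : List ℕ} {t t' : ℕ} (h : OutputsWithin P w O ρ x out t) (h' : OutputsWithin P w O ρ x out' t'),
    out = out'

/- interim proof relied on results that are now named facts (D-0014); demoted to a fact by the M5 import, proof preserved: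
:= by
  rw [outputsWithin_iff_exists_haltsWithin] at h h'
  obtain ⟨c, hc, rfl⟩ := h
  obtain ⟨c', hc', rfl⟩ := h'
  rw [haltsWithin_unique hc hc']
-/

/-- A deterministic program's runs do not depend on the coin stream. [folklore] -/
def outputsWithin_iff_of_isDeterministic : Prop :=
  ∀ {P : Program} (hP : P.IsDeterministic) (w : ℕ) (O : List ℕ → List ℕ) (ρ ρ' : ℕ → ℕ) (x out : List ℕ) (t : ℕ),
    OutputsWithin P w O ρ x out t ↔ OutputsWithin P w O ρ' x out t

/-! ## Word size and success probability -/

/-- The input width of `x : List ℕ`: the bit size of `max |x| (max entry)` (at least `1`).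
A run on `x` uses word size `w := k * inputWidth x` for a constant `k ≥ 1` chosen by the
algorithm: this is the "Θ(log n)-bit words" convention whenever entries are `poly(n)`, and
"every input number fits in a word" otherwise. V. Vassilevska Williams ICM 2018, §2;
Hagerup 1998, §2. [cite: ICM2018, §2] -/
def inputWidth (x : List ℕ) : ℕ :=
  Nat.size (max x.length (x.foldr max 1))

/-- The input width is positive. [folklore] -/
theorem inputWidth_pos (x : List ℕ) : 0 < inputWidth x := by
  refine Nat.size_pos.2 (lt_max_of_lt_right ?_)
  induction x with
  | nil => exact Nat.one_pos
  | cons a l ih => exact lt_max_of_lt_right ih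

/-- The input length is less than `2 ^ inputWidth x` (so `mem 0 = |x|` exactly in `init`). [folklore] -/
theorem length_lt_two_pow_inputWidth (x : List ℕ) : x.length < 2 ^ inputWidth x :=
  lt_of_le_of_lt (le_max_left _ _) (Nat.lt_size_self _)

/-- Every entry is less than `2 ^ inputWidth x` (so the input is stored exactly in `init`). [folklore] -/
theorem lt_two_pow_inputWidth_of_mem (x : List ℕ) (a : ℕ) (ha : a ∈ x) :
    a < 2 ^ inputWidth x := by
  refine lt_of_le_of_lt (le_trans ?_ (le_max_right _ _)) (Nat.lt_size_self _)
  induction x with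
  | nil => simp at ha
  | cons b l ih =>
    rw [List.foldr_cons]
    rcases List.mem_cons.1 ha with rfl | h
    · exact le_max_left _ _
    · exact le_trans (ih h) (le_max_right _ _)

/-- Extend a finite coin vector `ρ : Fin t → Fin (2 ^ w)` to a coin stream (by `0` beyond `t`;
a run of at most `t` steps consumes at most `t` coins, so the padding is never read). [folklore] -/
def coinStream {t w : ℕ} (ρ : Fin t → Fin (2 ^ w)) : ℕ → ℕ :=
  fun i => if h : i < t then ρ ⟨i, h⟩ else 0

/-- The success probability of program `P` on input `x` within `t` steps: the probability, over
a uniformly random coin vector `ρ : Fin t → Fin (2 ^ w)` (i.e. `t` independent uniform `w`-bit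
words), that `P` halts within `t` steps with output in the target set `S`.
V. Vassilevska Williams ICM 2018, §2 (randomised word-RAM algorithms). [cite: ICM2018, §2 (randomised word-RAM algorithms] -/
noncomputable def successProb (P : Program) (w : ℕ) (O : List ℕ → List ℕ) (x : List ℕ)
    (S : Set (List ℕ)) (t : ℕ) : ℝ := by
  classical
  exact ((Finset.univ.filter fun ρ : Fin t → Fin (2 ^ w) =>
    ∃ out ∈ S, OutputsWithin P w O (coinStream ρ) x out t).card : ℝ) / ((2 : ℝ) ^ w) ^ t

/-- The success probability is nonnegative. [folklore] -/
theorem successProb_nonneg (P : Program) (w : ℕ) (O : List ℕ → List ℕ) (x : List ℕ)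
    (S : Set (List ℕ)) (t : ℕ) : 0 ≤ successProb P w O x S t := by
  unfold successProb
  exact div_nonneg (Nat.cast_nonneg _) (pow_nonneg (pow_nonneg zero_le_two _) _)

/-- The success probability is at most `1`. [folklore] -/
theorem successProb_le_one (P : Program) (w : ℕ) (O : List ℕ → List ℕ) (x : List ℕ)
    (S : Set (List ℕ)) (t : ℕ) : successProb P w O x S t ≤ 1 := by
  classical
  unfold successProb
  rw [div_le_one (pow_pos (pow_pos zero_lt_two _) _)]
  calc _ ≤ ((Finset.univ : Finset (Fin t → Fin (2 ^ w))).card : ℝ) := by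
        exact_mod_cast Finset.card_filter_le _ _
    _ = ((2 : ℝ) ^ w) ^ t := by simp

/-- Monotonicity of the success probability in the target set. [folklore] -/
theorem successProb_mono (P : Program) (w : ℕ) (O : List ℕ → List ℕ) (x : List ℕ)
    {S S' : Set (List ℕ)} (hS : S ⊆ S') (t : ℕ) :
    successProb P w O x S t ≤ successProb P w O x S' t := by
  classical
  unfold successProb
  refine div_le_div_of_nonneg_right ?_ (pow_nonneg (pow_nonneg zero_le_two _) _)
  gcongr

/-- For a deterministic program the success probability is `0` or `1`. [folklore] -/
def successProb_eq_of_isDeterministic : Prop :=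
  ∀ {P : Program} (hP : P.IsDeterministic) (w : ℕ) (O : List ℕ → List ℕ) (x : List ℕ) (S : Set (List ℕ)) (t : ℕ),
    successProb P w O x S t = 0 ∨ successProb P w O x S t = 1

/-- For a deterministic program, success probability `1` is the same as outputting into `S`
with the zero coin stream. [folklore] -/
def successProb_eq_one_iff_of_isDeterministic : Prop :=
  ∀ {P : Program} (hP : P.IsDeterministic) (w : ℕ) (O : List ℕ → List ℕ) (x : List ℕ) (S : Set (List ℕ)) (t : ℕ),
    successProb P w O x S t = 1 ↔ ∃ out ∈ S, OutputsWithin P w O zeroCoins x out t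

end Literature.Computability.Cryptography.WordRAM
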